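import Summits.BirchSwinnertonDyer.BirchSwinnertonDyer.Theorems.ByReductionTypeAtTwoPeriodDescentGamma1
import Literature.NumberTheory.EllipticCurves.ManinConstantQuadraticTwistClassCertificate
import HarnessLib

/-!
# Crux-triage r1-2 GEN 12 — binder checks for the (β) collapse of line `kato-free-lower-sandwich-two`
(crux `OrdMissingLowerBoundAtTwo`, item stmt-BirchSwinnertonDyer-19577; triage companion, seat 2).

Nothing here concludes a Theses decl; BSD is NOT proved here and the crux stays open.

Findings, all kernel-checked below:
* (J1) an OPTIMAL `Γ₁(N)`-datum has `c ≠ 0` from optimality alone (`c = 0` would force `ω₁ = 0`), so the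
  existence binder `exists_optimal_gamma1ParametrizationData` (the hypothesis of the lead's landed
  `periodDescentOfEisenstein_of_gamma1Optimal`, p667647) is not satisfiable by the zero-constant junk datum;
* (J2) under optimality `Λ₁(f) ≠ ⊥`;
* (B1) the tree holds a SECOND named fact for the same object, `stevens1989_exists_optimal_gamma1ParametrizationData`
  (Stevens 1989 Prop. (1.4)/(2.8), conductor level, with the `IsNewformOf` conjunct); at the conductor level it
  yields the lead's binder shape outright (`exists_optimal_gamma1_at_conductor_of_stevens1989`);
* (B2) the registered research stub `stub_periodDescentOfEisenstein` (skeleton v11, VERBATIM type) is ALSO a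
  theorem modulo the Stevens fact (`periodDescentOfEisenstein_of_stevens1989`), by the lead's own
  `periodDescent_of_gamma1Optimal`; i.e. the line binds to either named fact — the (β) rung carries no research
  content beyond a cite binder.
-/

set_option autoImplicit false
set_option linter.dupNamespace false

noncomputable section

open scoped MatrixGroups ModularForm
open CongruenceSubgroup Complex WeierstrassCurve Literature.NumberTheory.EllipticCurves
  Literature.NumberTheory.EllipticCurves.ModularForms

namespace Summit.BirchSwinnertonDyer.BirchSwinnertonDyer.Cruxes.OrdMissingLowerBoundAtTwo.TriageR1Seat2Gen12

section Junk

variable {W : WeierstrassCurve ℚ} {N : ℕ} [NeZero N]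

/-- (J1) `D.IsOptimal → D.c ≠ 0`: the zero-constant junk datum is not optimal. [folklore] -/
theorem maninConstant_ne_zero_of_isOptimal (D : Gamma1ParametrizationData W N) (h : D.IsOptimal) :
    D.c ≠ 0 := by
  intro hc
  obtain ⟨w, -, hw⟩ := h D.L.ω₁ D.L.ω₁_mem_lattice
  rw [hc, Int.cast_zero, zero_mul] at hw
  exact (by simpa using D.L.basis.ne_zero 0 : D.L.ω₁ ≠ 0) hw

/-- (J2) `D.IsOptimal → Λ₁(f) ≠ ⊥`. [folklore] -/
theorem periodLatticeGamma1_ne_bot_of_isOptimal (D : Gamma1ParametrizationData W N) (h : D.IsOptimal) :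
    periodLatticeGamma1 D.f ≠ ⊥ := by
  intro hbot
  obtain ⟨w, hw, hw'⟩ := h D.L.ω₁ D.L.ω₁_mem_lattice
  rw [hbot, AddSubgroup.mem_bot] at hw
  rw [hw, mul_zero] at hw'
  exact (by simpa using D.L.basis.ne_zero 0 : D.L.ω₁ ≠ 0) hw'

end Junk

/-- (B1) At the conductor level, Stevens' Prop. (1.4) gives the shape of the lead's binder
`exists_optimal_gamma1ParametrizationData` (the `X₀`-datum `D₀` and its lattice-optimality are not used).
[cite: Stevens1989, Prop. (1.4) p. 79 and (2.8) p. 88] -/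
theorem exists_optimal_gamma1_at_conductor_of_stevens1989
    (h14 : stevens1989_exists_optimal_gamma1ParametrizationData)
    (W₀ : WeierstrassCurve ℚ) [W₀.IsElliptic] [W₀.IsGloballyMinimal] [NeZero (W₀.conductorNorm ℤ)]
    (D₀ : ModularParametrizationData W₀ (W₀.conductorNorm ℤ)) :
    ∃ (W₁ : WeierstrassCurve ℚ) (_ : W₁.IsElliptic) (_ : W₁.IsGloballyMinimal)
      (D₁ : Gamma1ParametrizationData W₁ (W₀.conductorNorm ℤ)),
      IsIsogenous W₁ W₀ ∧ D₁.IsOptimal ∧ D₁.f = D₀.f := by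
  obtain ⟨W₁, i₁, i₂, D₁, hnf, hiso, hopt⟩ := h14 (W₀.conductorNorm ℤ) W₀ rfl
  exact ⟨W₁, i₁, i₂, D₁, IsIsogenous.symm_of_charZero hiso, hopt, hnf.unique D₀.isNewformOf⟩

open Summit.BirchSwinnertonDyer.Rank1Residual Literature.NumberTheory.EllipticCurves.Rank1Residual
  Literature.NumberTheory.EllipticCurves.Greenberg1999
  Summit.BirchSwinnertonDyer.BirchSwinnertonDyer.Theorems.PeriodDescentGamma1

/-- (B2) **The registered stub `stub_periodDescentOfEisenstein` (skeleton v11 of `kato-free-lower-sandwich-two`),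
type VERBATIM, modulo the Stevens named fact instead of `exists_optimal_gamma1ParametrizationData`.**
Witness `W₃ :=` Stevens' `X₁(N)`-optimal curve `W₁`; `f₁ = f₀` from the fact's `IsNewformOf` conjunct and
`IsNewformOf.unique`; `c₀` odd by Abbes–Ullmo at `2 ∤ N` (`N` odd from good ordinary reduction at `2`); then the
lead's `periodDescent_of_gamma1Optimal` (p667647).  `¬CM`, rank `0`, the `2`-torsion habitat, `χ`'s shape and the
PUB binder are unused, exactly as in the lead's version. [cite: Stevens1989, Prop. (1.4) p. 79 and (2.8) p. 88] -/
theorem periodDescentOfEisenstein_of_stevens1989 (h14 : stevens1989_exists_optimal_gamma1ParametrizationData) :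
    Literature.Uncategorized.OrdPublishedInputsAtTwo →
    abbesUllmo_not_dvd_maninConstant_of_not_dvd_level →
    ∀ (E₀ : WeierstrassCurve ℚ) [E₀.IsElliptic] [E₀.IsGloballyMinimal] [NeZero (E₀.conductorNorm ℤ)]
      (D₀ : ModularParametrizationData E₀ (E₀.conductorNorm ℤ)),
      (∀ z ∈ D₀.L.lattice, ∃ w ∈ periodLattice D₀.f, z = D₀.c * w) →
      ¬ E₀.HasCM → E₀.analyticRank = 0 → GoodOrd E₀ 2 →
      (∃ (W₁ : WeierstrassCurve ℚ) (_ : W₁.IsElliptic) (_ : W₁.IsGloballyMinimal),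
        IsIsogenous E₀ W₁ ∧ ∃ x : ℚ, HasRationalTwoTorsionX W₁ x) →
      ∀ (s : ℕ) (m : Gamma0 (E₀.conductorNorm ℤ) → ℤ),
        (∀ γ, (cuspSymbol D₀.f γ).re = m γ * (plusPeriod D₀.f / 2)) →
      ∀ χ : ZMod (E₀.conductorNorm ℤ) → ZMod (2 ^ (s + 1)),
        (∀ γ, ((m γ : ℤ) : ZMod (2 ^ (s + 1))) = χ (Gamma0Map (E₀.conductorNorm ℤ) γ)) →
      ∃ (W₃ : WeierstrassCurve ℚ) (_ : W₃.IsElliptic) (_ : W₃.IsGloballyMinimal),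
        IsIsogenous E₀ W₃ ∧ ∃ r : ℚ, W₃.realPeriodRat = (r : ℝ) * E₀.realPeriodRat ∧ ((s : ℤ) + 1) ≤ padicValRat 2 r := by
  intro _ hAU E₀ _ _ _ D₀ hopt _ _ hgo _ s m hm χ hχ
  have hord : IsOrdinaryAt E₀ 2 := hgo
  have hN2 : ¬ 2 ∣ E₀.conductorNorm ℤ := not_dvd_level_of_isNewformOf D₀.isNewformOf hord.1
  have hc₀ : ¬ (2 : ℤ) ∣ D₀.maninConstant := by exact_mod_cast hAU E₀ D₀ hopt 2 Nat.prime_two hN2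
  obtain ⟨W₁, i₁, i₂, D₁, hnf, hiso, hopt₁⟩ := h14 (E₀.conductorNorm ℤ) E₀ rfl
  have hf : D₁.f = D₀.f := hnf.unique D₀.isNewformOf
  exact ⟨W₁, i₁, i₂, hiso, periodDescent_of_gamma1Optimal D₀ hopt hc₀ D₁ hf hopt₁ s m hm χ hχ⟩

end Summit.BirchSwinnertonDyer.BirchSwinnertonDyer.Cruxes.OrdMissingLowerBoundAtTwo.TriageR1Seat2Gen12

end
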